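import Summits.HodgeConjecture.HodgeConjecture.Theorems.Ring2AbelianAllWeilSignature
import Literature.NumberTheory.NumberFields.CMQuadraticExtension
import Literature.AlgebraicGeometry.VanGeemen1994.WeilDiscriminantOfHyperbolic
import HarnessLib

/-!
# Ring 2 · AbelianAll (ab-weil-1, gen 10, part 8a) — `K_d = ℚ(√-d)` as a CM field and the Hermitian
  Gram matrix of a Weil carrier witness

research route, not a corollary; conditional on HC_CM plus one named minimal statement.
Cell line: research route conditional on HC_CM; not a corollary; Q11.4-sentence-2 already refuted in dim ≥ 3.
`HC_CM` (`Theses.RankFourFaces.CMAbelianHodge`) does not occur in this file and no open case of the Hodge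
conjecture is claimed; this is the field-arithmetic layer of part 8 (Landherr UNIQUENESS on the carriers,
`Ring2AbelianAllWeilLandherrUniqueness`): van Geemen, LNM 1594, Lemma 5.2 (1)–(3).

## What is proved (0 sorry)

* §0 `K_d = ℚ[X]/(X² + d)` (`VanGeemen1994.weilField d`) is a CM FIELD for `d ≥ 1` (`isCMField_weilField`,
  under the `Fact (Irreducible (X² + d))` instance supplied by `fact_irreducible_weilPoly`; Mathlib's
  `NumberField.IsCMField` through the tree's `isCMField_of_isTotallyReal_of_sq_eq_neg_natCast`); its complex
  conjugation is `√-d ↦ -√-d` (`complexConj_weilSqrt`), `\overline{a + b√-d} = a - b√-d`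
  (`complexConj_add_mul_weilSqrt`) and `z · z̄ = Nm_{K_d/ℚ}(z)` (`mul_complexConj_eq_algebraMap_norm`); every
  complex embedding sends `√-d` to `± i√d` (`embedding_weilSqrt_eq_or`).
* §1 the Gram matrix `Ψ = a + b√-d` (`VanGeemen1994.weilGramMatrix`) of a carrier witness of
  `VanGeemen1994.HasWeilDiscriminantNondeg` is `σ`-HERMITIAN: `E` alternating and `E(φ^*x, φ^*y) = d E(x, y)`
  give `ᵗa = a`, `ᵗb = -b` (`weilGram_coeff_symm`), whence `ᵗ(σΨ) = Ψ` (`conjTranspose_weilGramMatrix`) —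
  Lemma 5.2 (1)–(2): "`H(y, x) = \overline{H(x, y)}`".
* §2 DISCRIMINANT: two witnesses whose classes agree in `ℚ^×/Nm(K_d^×)`
  (`VanGeemen1994.weilNormResidueGroup d`) have `det Ψ = det Ψ' · z z̄` for some `z ∈ K_d^×`
  (`exists_det_eq_det_mul_norm_of_mk_eq`) — Lemma 5.2 (3) / 4.14.

What is NOT proved or claimed: anything about abelian varieties beyond the symmetry of the Gram
coefficients; no Literature fact is introduced; no internally-minted statement is cited as a fact.

## References

* [vanGeemen1994HodgeAV] B. van Geemen, An introduction to the Hodge conjecture for abelian varieties,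
  LNM 1594 (1994), 4.9, 4.14, Lemma 5.2 (1)–(4), 5.3, (5.4.1).
* [Landherr1936HermitianForms] W. Landherr, Äquivalenz Hermitescher Formen über einen beliebigen
  algebraischen Zahlkörper, Abh. Math. Sem. Hamburg 11 (1936) 245–248 (modern account: G. Shimura,
  Arithmetic of Hermitian forms, Doc. Math. 13 (2008), Thm. 2.2 (i)).
-/

noncomputable section

set_option linter.dupNamespace false

open CategoryTheory Polynomial NumberField
open Literature.AlgebraicGeometry Literature.AlgebraicGeometry.Motives
open Literature.AlgebraicGeometry.HodgeTheory
open Literature.AlgebraicGeometry.VanGeemen1994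
open Literature.AlgebraicTopology.SingularHomology
open Literature.NumberTheory.QuadraticForms

namespace Summit.HodgeConjecture.HodgeConjecture.Ring2.AbelianAll

/-! ### §0 `K_d = ℚ(√-d)` is a CM field; its complex conjugation -/

section WeilFieldCM

variable {d : ℕ}

/-- `X² + d` is irreducible over `ℚ` for `d ≥ 1`, packaged as the `Fact` instance under which Mathlib makes
`K_d = ℚ[X]/(X² + d)` a `Field` and a `NumberField`. [cite: vanGeemen1994HodgeAV, Lemma 5.2] -/
theorem fact_irreducible_weilPoly (hd : 0 < d) : Fact (Irreducible (X ^ 2 + C (d : ℚ) : ℚ[X])) :=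
  ⟨irreducible_X_sq_add_C hd⟩

/-- Conversely the `Fact` instance forces `d ≥ 1` (`X²` is reducible). [folklore] -/
theorem pos_of_fact_irreducible_weilPoly [h : Fact (Irreducible (X ^ 2 + C (d : ℚ) : ℚ[X]))] : 0 < d := by
  rcases Nat.eq_zero_or_pos d with h0 | hd
  · exfalso
    have h' := h.out
    rw [h0, Nat.cast_zero, map_zero, add_zero] at h'
    rcases h'.isUnit_or_isUnit (pow_two (X : ℚ[X])) with hX | hX <;> exact Polynomial.not_isUnit_X hX
  · exact hd

/-- `(√-d)² = -d` in `K_d`, in the `ℕ`-cast spelling. [cite: vanGeemen1994HodgeAV, Lemma 5.2 (2)] -/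
theorem weilSqrt_sq_eq_neg_natCast : weilSqrt d ^ 2 = -(d : weilField d) := by
  rw [sq, weilSqrt_mul_self_eq_algebraMap, map_neg, map_natCast (algebraMap ℚ (weilField d))]

/-- Every complex embedding of `K_d` restricts to the inclusion on `ℚ`. [folklore] -/
theorem embedding_algebraMap (τ : weilField d →+* ℂ) (r : ℚ) : τ (algebraMap ℚ (weilField d) r) = (r : ℂ) := by
  rw [← RingHom.comp_apply, eq_ratCast]

/-- Every complex embedding of `K_d` sends `√-d` to `± i√d`. [folklore] -/
theorem embedding_weilSqrt_eq_or (τ : weilField d →+* ℂ) :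
    τ (weilSqrt d) = Complex.I * (Real.sqrt d : ℂ) ∨ τ (weilSqrt d) = -(Complex.I * (Real.sqrt d : ℂ)) := by
  apply eq_or_eq_neg_of_sq_eq_sq
  have h2 : τ (weilSqrt d) ^ 2 = -(d : ℂ) := by
    rw [sq, ← map_mul, weilSqrt_mul_self_eq_algebraMap, embedding_algebraMap]
    push_cast
    ring
  rw [h2, I_mul_sqrt_sq]

variable [Fact (Irreducible (X ^ 2 + C (d : ℚ) : ℚ[X]))]

/-- **`K_d` is a CM field** (`d ≥ 1`): a quadratic extension of the totally real field `ℚ` containing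
`√-d`. [cite: vanGeemen1994HodgeAV, 4.9] -/
theorem isCMField_weilField : IsCMField (weilField d) :=
  haveI : Algebra.IsQuadraticExtension ℚ (weilField d) := { finrank_eq_two' := finrank_weilField d }
  Literature.NumberTheory.NumberFields.isCMField_of_isTotallyReal_of_sq_eq_neg_natCast ℚ (weilField d)
    (pos_of_fact_irreducible_weilPoly (d := d)) (weilSqrt_sq_eq_neg_natCast (d := d))

variable [IsCMField (weilField d)]

/-- Complex conjugation of `K_d` fixes `ℚ`. [folklore] -/
theorem complexConj_algebraMap (r : ℚ) :
    IsCMField.complexConj (weilField d) (algebraMap ℚ (weilField d) r) = algebraMap ℚ (weilField d) r := by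
  rw [eq_ratCast (algebraMap ℚ (weilField d)) r, map_ratCast]

/-- **Complex conjugation of `K_d` is `√-d ↦ -√-d`** (seen through the embedding `√-d ↦ i√d`).
[cite: vanGeemen1994HodgeAV, Lemma 5.2 (2)] -/
theorem complexConj_weilSqrt : IsCMField.complexConj (weilField d) (weilSqrt d) = -weilSqrt d := by
  obtain ⟨σ, hσε, -⟩ := exists_ringHom_weilField_sqrt d
  apply σ.injective
  rw [IsCMField.complexEmbedding_complexConj, hσε, map_neg, hσε, conj_I_mul_sqrt]

/-- `\overline{a + b√-d} = a - b√-d`. [cite: vanGeemen1994HodgeAV, Lemma 5.2 (2)] -/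
theorem complexConj_add_mul_weilSqrt (a b : ℚ) :
    IsCMField.complexConj (weilField d) (algebraMap ℚ (weilField d) a + algebraMap ℚ (weilField d) b * weilSqrt d) =
      algebraMap ℚ (weilField d) a - algebraMap ℚ (weilField d) b * weilSqrt d := by
  rw [map_add, map_mul, complexConj_algebraMap, complexConj_algebraMap, complexConj_weilSqrt, mul_neg, sub_eq_add_neg]

/-- **`z · z̄ = Nm_{K_d/ℚ}(z)`**. [cite: vanGeemen1994HodgeAV, 4.14] -/
theorem mul_complexConj_eq_algebraMap_norm (z : weilField d) :
    z * IsCMField.complexConj (weilField d) z = algebraMap ℚ (weilField d) (Algebra.norm ℚ z) := by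
  have hdQ : (0 : ℚ) < (d : ℚ) := by exact_mod_cast pos_of_fact_irreducible_weilPoly (d := d)
  exact Motives.mul_conj_eq_algebraMap_norm hdQ (weilSqrt_mul_self_eq_algebraMap d)
    (exists_eq_algebraMap_add_mul_weilSqrt d) (IsCMField.complexConj (weilField d) : weilField d →+* weilField d)
    complexConj_weilSqrt z

end WeilFieldCM

/-! ### §1 The Gram matrix of a carrier witness is Hermitian -/

section Hermitian

/-- **`a` is symmetric and `b` antisymmetric**: for a frame `x` with `Q(x_i, φ^*x_j) = a_ij ω`,
`Q(x_i, x_j) = b_ij ω` (`Q = Q_{h_K}`, `h_K = d·e^*a + φ^*e^*a`), alternation of `Q` and the `K`-symmetry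
`Q(φ^*x, φ^*y) = d Q(x, y)` (so `Q(φ^*x, y) = -Q(x, φ^*y)`) give `ᵗa = a`, `ᵗb = -b` — the Hermitian symmetry
`H(y, x) = \overline{H(x, y)}` of `H = a + b√-d`. [cite: vanGeemen1994HodgeAV, Lemma 5.2 (1)–(2)] -/
theorem weilGram_coeff_symm {A : AbelianVariety ℂ} {φ : A ⟶ A} {d m k : ℕ} (hd : 0 < d) (hA' : A.dim = m + 1)
    (hφ : φ ≫ φ = -(d • 𝟙 A)) (e : ProjectiveEmbedding A.X) (a : complexBetti (projectiveSpace e.n ℂ) 2)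
    (x : Fin k → complexBetti A.X 1) {ω : complexBetti A.X (2 + 2 * m)} (hω0 : ω ≠ 0)
    {am bm : Matrix (Fin k) (Fin k) ℚ}
    (hQ : ∀ i j, polarizationPairingOne A.X
          ((d : ℂ) • complexBetti.map e.ι 2 a + complexBetti.map φ.hom.hom.hom 2 (complexBetti.map e.ι 2 a)) m
          (x i) (complexBetti.map φ.hom.hom.hom 1 (x j)) = ((am i j : ℚ) : ℂ) • ω ∧
        polarizationPairingOne A.X
          ((d : ℂ) • complexBetti.map e.ι 2 a + complexBetti.map φ.hom.hom.hom 2 (complexBetti.map e.ι 2 a)) m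
          (x i) (x j) = ((bm i j : ℚ) : ℂ) • ω) :
    am.transpose = am ∧ bm.transpose = -bm := by
  set hK := (d : ℂ) • complexBetti.map e.ι 2 a + complexBetti.map φ.hom.hom.hom 2 (complexBetti.map e.ι 2 a)
    with hKdef
  set Q := polarizationPairingOne A.X hK m with hQdef
  set T := (complexBetti.map φ.hom.hom.hom 1).hom with hTdef
  have hd0 : (d : ℂ) ≠ 0 := Nat.cast_ne_zero.2 hd.ne'
  have hT2 : ∀ v, T (T v) = -((d : ℂ) • v) := fun v => complexBetti_map_map_one_of_comp_self hφ v
  have hQTT : ∀ v w, Q (T v) (T w) = (d : ℂ) • Q v w :=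
    fun v w => polarizationPairingOne_map_map_ksymm hA' hd hφ e a v w
  have hQswap : ∀ v w, Q w v = -Q v w := fun v w => polarizationPairingOne_swap hK m v w
  -- `Q(Tv, w) = -Q(v, Tw)`
  have hQT : ∀ v w, Q (T v) w = -Q v (T w) := by
    intro v w
    have h := hQTT v (T w)
    rw [hT2, map_neg, map_smul] at h
    have h' : (d : ℂ) • (Q (T v) w + Q v (T w)) = 0 := by rw [smul_add, ← h, add_neg_cancel]
    exact eq_neg_of_add_eq_zero_left ((smul_eq_zero.1 h').resolve_left hd0)
  have hcast : ∀ r s : ℚ, ((r : ℂ) • ω = (s : ℂ) • ω) → r = s := fun r s h =>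
    Rat.cast_injective (α := ℂ) (smul_left_injective ℂ hω0 h)
  refine ⟨Matrix.ext fun i j => ?_, Matrix.ext fun i j => ?_⟩
  · rw [Matrix.transpose_apply]
    apply hcast
    rw [← (hQ j i).1, ← (hQ i j).1, hQswap (T (x i)) (x j), hQT, neg_neg]
  · rw [Matrix.transpose_apply, Matrix.neg_apply]
    apply hcast
    rw [← (hQ j i).2, Rat.cast_neg, neg_smul, ← (hQ i j).2, hQswap]

variable {d : ℕ} [Fact (Irreducible (X ^ 2 + C (d : ℚ) : ℚ[X]))] [IsCMField (weilField d)]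

/-- **The Gram matrix `Ψ = a + b√-d` with `ᵗa = a`, `ᵗb = -b` is `σ`-Hermitian: `ᵗ(σΨ) = Ψ`.**
[cite: vanGeemen1994HodgeAV, Lemma 5.2 (2)] -/
theorem conjTranspose_weilGramMatrix {k : ℕ} {am bm : Matrix (Fin k) (Fin k) ℚ} (ha : am.transpose = am)
    (hb : bm.transpose = -bm) :
    (weilGramMatrix d am bm).transpose.map (IsCMField.complexConj (weilField d)) = weilGramMatrix d am bm := by
  ext i j
  have ha' : am j i = am i j := by rw [← Matrix.transpose_apply am i j, ha]
  have hb' : bm j i = -bm i j := by rw [← Matrix.transpose_apply bm i j, hb, Matrix.neg_apply]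
  rw [Matrix.map_apply, Matrix.transpose_apply, weilGramMatrix_apply, weilGramMatrix_apply, ha', hb']
  generalize am i j = p
  generalize bm i j = r
  -- normalise `algebraMap ℚ K_d` to the rational cast (instance-independent), then conjugate
  simp only [map_add, map_mul, map_neg, eq_ratCast, map_ratCast, complexConj_weilSqrt, neg_mul_neg]

end Hermitian

/-! ### §2 Equal discriminant classes -/

section DetNorm

variable {d : ℕ} [Fact (Irreducible (X ^ 2 + C (d : ℚ) : ℚ[X]))] [IsCMField (weilField d)]

/-- **Same discriminant class ⟹ `det Ψ = det Ψ' · z z̄`.** [cite: vanGeemen1994HodgeAV, Lemma 5.2 (3) and 4.14] -/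
theorem exists_det_eq_det_mul_norm_of_mk_eq {k : ℕ} {Ψ Ψ' : Matrix (Fin k) (Fin k) (weilField d)} {q q' : ℚˣ}
    (hdet : Ψ.det = algebraMap ℚ (weilField d) (q : ℚ)) (hdet' : Ψ'.det = algebraMap ℚ (weilField d) (q' : ℚ))
    (hqq : (QuotientGroup.mk q : weilNormResidueGroup d) = QuotientGroup.mk q') :
    ∃ z : weilField d, z ≠ 0 ∧ Ψ.det = Ψ'.det * (z * IsCMField.complexConj (weilField d) z) := by
  have hmem : q'⁻¹ * q ∈ normUnitsSubgroup ℚ (weilField d) := QuotientGroup.eq.1 hqq.symm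
  obtain ⟨kU, hk⟩ := mem_normUnitsSubgroup_iff.1 hmem
  refine ⟨(kU : weilField d), kU.ne_zero, ?_⟩
  rw [mul_complexConj_eq_algebraMap_norm, hk, hdet, hdet', ← map_mul, Units.val_mul, Units.val_inv_eq_inv_val,
    mul_inv_cancel_left₀ q'.ne_zero]

end DetNorm

end Summit.HodgeConjecture.HodgeConjecture.Ring2.AbelianAll

end
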